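import Mathlib
import Summits.MatrixMultiplication.MatrixMultiplication.Theorems.SnSubsetDichotomyPolynomialSlackPinningNormalized
import Summits.MatrixMultiplication.MatrixMultiplication.Theorems.SnSubsetDichotomyPolynomialSlackKeptTerm
import Summits.MatrixMultiplication.MatrixMultiplication.Theorems.SnSubsetDichotomyPolynomialSlackPairParseval
import Summits.MatrixMultiplication.MatrixMultiplication.Theorems.SnSubsetDichotomyPolynomialSlackPairLightEnergy
import Summits.MatrixMultiplication.MatrixMultiplication.Theorems.SnSubsetDichotomyPolynomialSlackStubSplit
import Summits.MatrixMultiplication.MatrixMultiplication.Theorems.SnSubsetDichotomyPolynomialSlackMarginals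

/-!
# The kept term when the quotients `B = T⁻¹U` and `C = U⁻¹S` are split

Crux `Summit.MatrixMultiplication.MatrixMultiplication.Theses.SnSubsetDichotomy.PolynomialSlack`
(item `stmt-MatrixMultiplication-8306`), level-one programme, line transport-split-hull (lead c6,
"beyond one half"): REDUCTION TO THE KEPT TERM when the quotients `B = T⁻¹U` and `C = U⁻¹S` of a
parity-pure TPP triple `S, T, U ⊆ S_n` are NON-DENSE, `K_B := n!/(|T||U|) ≥ 16M` and
`K_C := n!/(|U||S|) ≥ 16M`.

Notation: `N = |S||T||U|`, `α = |S||T|`, `β = |T||U|`, `γ = |U||S|` (`αβγ = N²`), `K_A = n!/α`,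
`F := n!√(n!)/N` (`K_A K_B K_C = F²`), centred profiles `a = d_A - 1/n`, `b = d_B - 1/n`,
`c = d_C - 1/n` of the three quotients, heavy thresholds `θ_B = n!/(βnM) = K_B/(nM) ≥ 16/n`,
`θ_C = K_C/(nM)`, heavy parts `p_B = b·[θ_B ≤ d_B]`, `p_C`, light parts `l_B = b - p_B`, `l_C`.
The tree lemma `kept_ge_of_split` (split `a = a + 0`, `b = p_B + l_B`, `c = p_C + l_C`) is fed with

* the pinning `pinning_normalized` (`1 - δ₀ ≤ -(n-1)·Σ abc`,
  `δ₀ = n!/(2N) + n!√(n!)/(2N√(n(n-1)/6))`);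
* the Parseval bounds `pair_parseval` (`Σ a² ≤ E_A := K_A/(n-1)`, `Σ b² ≤ E_B`, `Σ c² ≤ E_C`, hence
  also `Σ p_B² ≤ E_B` cellwise);
* the light-cell energies `pair_light_energy` (`Σ l_B² ≤ γ'·E_B`, `Σ l_C² ≤ γ'·E_C` with
  `γ' = 100(1 + log n)L/M`, using `nθ_B = K_B/M`, `log(4n·n!/β) ≤ L` and `1/n ≤ 1/(n-1)`),

and its loss `3(n-1)√γ'√(E_A E_B E_C)` equals `3√γ'·F/√(n-1)` because
`E_A E_B E_C = F²/(n-1)³`: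

* `kept_split_BC` — `1 - δ₀ - 3√γ'·F/√(n-1) ≤ -(n-1)·Σ_{ijk} a_{ij} (p_B)_{jk} (p_C)_{ki}`.

The real bookkeeping is isolated in `kept_split_BC_core`, where the quotient sizes are abstract
positive reals.
-/

namespace Summit.MatrixMultiplication.MatrixMultiplication.Theorems.PolynomialSlack

open scoped BigOperators
open Literature.Combinatorics.Additive (TripleProductProperty)

-- `Summit.<Summit>.<Problem>` is the tree's mandated summit-side namespace (CONVENTIONS §2); for
-- this single-conjunct summit the two coincide, so each declaration silences `dupNamespace`.
set_option linter.dupNamespace false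

/-- Heavy thresholds are above the mean: `16M ≤ F/β`, `M ≥ 1`, `β, n > 0` give
`1/n ≤ F/(βnM)` (indeed `F/(βnM) ≥ 16/n`). [folklore] -/
private theorem keptSplitBC_threshold {F β M n : ℝ} (hβ : 0 < β) (hM : 1 ≤ M) (hn : 0 < n)
    (hK : 16 * M ≤ F / β) : 1 / n ≤ F / (β * n * M) := by
  have hM0 : 0 < M := by linarith
  rw [div_le_div_iff₀ hn (by positivity), one_mul]
  have h1 : 16 * M * β ≤ F := by rwa [le_div_iff₀ hβ] at hK
  nlinarith [mul_pos hβ hM0, mul_pos (mul_pos hβ hM0) hn]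

/-- Light-cell energy in the form needed by `kept_ge_of_split`: from
`E ≤ c·(nθ)·L_B/n` with `θ = F/(βnM)`, `L_B ≤ L`, `L, F, c ≥ 0`, `M ≥ 1`, `n > 1`, one gets
`E ≤ (cL/M)·(F/β/(n-1))` (`nθ = (F/β)/M` and `1/n ≤ 1/(n-1)`). [folklore] -/
private theorem keptSplitBC_light {E F β M n L LB c : ℝ} (hβ : 0 < β) (hM : 1 ≤ M) (hn : 1 < n)
    (hc : 0 ≤ c) (hL : LB ≤ L) (hL0 : 0 ≤ L) (hF : 0 ≤ F)
    (hE : E ≤ c * (n * (F / (β * n * M))) * LB / n) :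
    E ≤ c * L / M * (F / β / (n - 1)) := by
  have hM0 : 0 < M := by linarith
  have hn0 : 0 < n := by linarith
  have hn1 : 0 < n - 1 := by linarith
  have hnθ : n * (F / (β * n * M)) = F / β / M := by field_simp
  rw [hnθ] at hE
  have h0 : 0 ≤ c * (F / β / M) := by positivity
  calc E ≤ c * (F / β / M) * LB / n := hE
    _ ≤ c * (F / β / M) * L / n := by gcongr
    _ ≤ c * (F / β / M) * L / (n - 1) :=
        div_le_div_of_nonneg_left (by positivity) hn1 (by linarith)
    _ = c * L / M * (F / β / (n - 1)) := by
        field_simp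

/-- The loss identity: for `F ≥ 0`, `α, β, γ, N, m > 0` with `αβγ = N²`,
`m·√((F/α/m)(F/β/m)(F/γ/m)) = F√F/N/√m` (both sides are non-negative with square
`F³/(N² m)`). [folklore] -/
private theorem keptSplitBC_sqrt_identity {F α β γ N m : ℝ} (hF : 0 ≤ F) (hα : 0 < α)
    (hβ : 0 < β) (hγ : 0 < γ) (hN : 0 < N) (hαβγ : α * β * γ = N ^ 2) (hm : 0 < m) :
    m * Real.sqrt (F / α / m * (F / β / m) * (F / γ / m)) = F * Real.sqrt F / N / Real.sqrt m := by
  have hsm : 0 < Real.sqrt m := Real.sqrt_pos.2 hm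
  have hsm' : Real.sqrt m ≠ 0 := hsm.ne'
  have hG0 : 0 ≤ F * Real.sqrt F / (N * m * Real.sqrt m) := by positivity
  have hG2 : F / α / m * (F / β / m) * (F / γ / m) =
      (F * Real.sqrt F / (N * m * Real.sqrt m)) ^ 2 := by
    have e1 : F / α / m * (F / β / m) * (F / γ / m) = F ^ 3 / (α * β * γ) / m ^ 3 := by
      field_simp
    rw [e1, hαβγ, div_pow, mul_pow, mul_pow, mul_pow, Real.sq_sqrt hF, Real.sq_sqrt hm.le]
    field_simp
  rw [hG2, Real.sqrt_sq hG0]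
  field_simp

/-- **Kept term for split `B` and `C`, abstract form.** The real bookkeeping of `kept_split_BC`
with the quotient sizes `α = |S||T|`, `β = |T||U|`, `γ = |U||S|` and `N = |S||T||U|` replaced by
positive reals with `αβγ = N²`: given the Parseval bounds `(n-1)Σ(d-1/n)² ≤ n!/α, n!/β, n!/γ`, the
light-cell energies `Σ l_B² ≤ 100(1+log n)(nθ_B)log(4n·n!/β)/n` (`θ_B = n!/(βnM)`), same for `C`,
`log(4n·n!/β), log(4n·n!/γ) ≤ L`, `M, L ≥ 1`, and the pinning
`1 - δ₀ ≤ -(n-1)Σ (d_A-1/n)(d_B-1/n)(d_C-1/n)`, the kept term obeys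
`1 - δ₀ - 3√(100(1+log n)L/M)·(n!√(n!)/N)/√(n-1) ≤ -(n-1)Σ (d_A-1/n)·p_B·p_C`
(`kept_ge_of_split` with `E_A = n!/α/(n-1)` etc., `γ' = 100(1+log n)L/M`). [folklore] -/
theorem kept_split_BC_core {n : ℕ} (hn : 40 ≤ n) {α β γ N : ℝ} (hα : 0 < α) (hβ : 0 < β)
    (hγ : 0 < γ) (hN : 0 < N) (hαβγ : α * β * γ = N ^ 2)
    (dA dB dC pB pC : Fin n → Fin n → ℝ) (M L : ℝ) (hM : 1 ≤ M) (hL : 1 ≤ L)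
    (hLB : Real.log (4 * n * n.factorial / β) ≤ L) (hLC : Real.log (4 * n * n.factorial / γ) ≤ L)
    (hpB : ∀ j k, pB j k =
      if (n.factorial : ℝ) / (β * n * M) ≤ dB j k then dB j k - 1 / n else 0)
    (hpC : ∀ k i, pC k i =
      if (n.factorial : ℝ) / (γ * n * M) ≤ dC k i then dC k i - 1 / n else 0)
    (hA2 : ((n : ℝ) - 1) * ∑ i : Fin n, ∑ j : Fin n, (dA i j - 1 / n) ^ 2 ≤ (n.factorial : ℝ) / α)
    (hB2 : ((n : ℝ) - 1) * ∑ j : Fin n, ∑ k : Fin n, (dB j k - 1 / n) ^ 2 ≤ (n.factorial : ℝ) / β)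
    (hC2 : ((n : ℝ) - 1) * ∑ k : Fin n, ∑ i : Fin n, (dC k i - 1 / n) ^ 2 ≤ (n.factorial : ℝ) / γ)
    (hlB : ∑ j : Fin n, ∑ k : Fin n,
        (if (n.factorial : ℝ) / (β * n * M) ≤ dB j k then (0 : ℝ) else dB j k - 1 / n) ^ 2 ≤
      100 * (1 + Real.log n) * ((n : ℝ) * ((n.factorial : ℝ) / (β * n * M))) *
        Real.log (4 * n * n.factorial / β) / n)
    (hlC : ∑ k : Fin n, ∑ i : Fin n,
        (if (n.factorial : ℝ) / (γ * n * M) ≤ dC k i then (0 : ℝ) else dC k i - 1 / n) ^ 2 ≤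
      100 * (1 + Real.log n) * ((n : ℝ) * ((n.factorial : ℝ) / (γ * n * M))) *
        Real.log (4 * n * n.factorial / γ) / n)
    (hpin : 1 - (n.factorial : ℝ) / (2 * N) -
        (n.factorial : ℝ) * Real.sqrt (n.factorial : ℝ) /
          (2 * N * Real.sqrt (((n * (n - 1) : ℕ) : ℝ) / 6)) ≤
      -((n : ℝ) - 1) * ∑ i : Fin n, ∑ j : Fin n, ∑ k : Fin n,
        (dA i j - 1 / n) * (dB j k - 1 / n) * (dC k i - 1 / n)) :
    1 - ((n.factorial : ℝ) / (2 * N) +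
          (n.factorial : ℝ) * Real.sqrt (n.factorial : ℝ) /
            (2 * N * Real.sqrt (((n * (n - 1) : ℕ) : ℝ) / 6)) +
          3 * Real.sqrt (100 * (1 + Real.log n) * L / M) *
            ((n.factorial : ℝ) * Real.sqrt (n.factorial : ℝ) / N) / Real.sqrt ((n : ℝ) - 1)) ≤
      -((n : ℝ) - 1) * ∑ i : Fin n, ∑ j : Fin n, ∑ k : Fin n,
        (dA i j - 1 / n) * pB j k * pC k i := by
  have hF0 : (0 : ℝ) ≤ (n.factorial : ℝ) := Nat.cast_nonneg _
  have hn40 : (40 : ℝ) ≤ n := by exact_mod_cast hn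
  have hn1 : (1 : ℝ) ≤ n := by linarith
  have hn1' : (1 : ℝ) < n := by linarith
  have hm : (0 : ℝ) < (n : ℝ) - 1 := by linarith
  have hM0 : 0 < M := by linarith
  have hL0 : 0 ≤ L := by linarith
  have hlog : 0 ≤ Real.log n := Real.log_natCast_nonneg n
  have hc0 : (0 : ℝ) ≤ 100 * (1 + Real.log n) := by positivity
  -- the energies `E_A, E_B, E_C` and the smallness parameter `γ'` are non-negative
  have hEA0 : (0 : ℝ) ≤ (n.factorial : ℝ) / α / ((n : ℝ) - 1) := by positivity
  have hEB0 : (0 : ℝ) ≤ (n.factorial : ℝ) / β / ((n : ℝ) - 1) := by positivity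
  have hEC0 : (0 : ℝ) ≤ (n.factorial : ℝ) / γ / ((n : ℝ) - 1) := by positivity
  have hg0 : (0 : ℝ) ≤ 100 * (1 + Real.log n) * L / M := by positivity
  -- Parseval bounds divided by `n - 1`
  have hpa : ∑ i : Fin n, ∑ j : Fin n, (dA i j - 1 / n) ^ 2 ≤
      (n.factorial : ℝ) / α / ((n : ℝ) - 1) := by
    rw [le_div_iff₀ hm, mul_comm]; exact hA2
  have hb2 : ∑ j : Fin n, ∑ k : Fin n, (dB j k - 1 / n) ^ 2 ≤
      (n.factorial : ℝ) / β / ((n : ℝ) - 1) := by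
    rw [le_div_iff₀ hm, mul_comm]; exact hB2
  have hc2 : ∑ k : Fin n, ∑ i : Fin n, (dC k i - 1 / n) ^ 2 ≤
      (n.factorial : ℝ) / γ / ((n : ℝ) - 1) := by
    rw [le_div_iff₀ hm, mul_comm]; exact hC2
  -- the heavy part `p_B` is dominated cellwise by `b`
  have hpb : ∑ j : Fin n, ∑ k : Fin n, pB j k ^ 2 ≤ (n.factorial : ℝ) / β / ((n : ℝ) - 1) := by
    refine le_trans (Finset.sum_le_sum fun j _ => Finset.sum_le_sum fun k _ => ?_) hb2
    rw [hpB j k]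
    split_ifs
    · exact le_rfl
    · exact ((zero_pow two_ne_zero).trans_le (sq_nonneg _))
  -- the splits `a = a + 0`, `b = p_B + l_B`, `c = p_C + l_C`
  have hasplit : ∀ i j, dA i j - 1 / n = (dA i j - 1 / n) + 0 := fun i j => (add_zero _).symm
  have hbsplit : ∀ j k, dB j k - 1 / n = pB j k +
      (if (n.factorial : ℝ) / (β * n * M) ≤ dB j k then (0 : ℝ) else dB j k - 1 / n) := by
    intro j k
    rw [hpB j k]
    split_ifs <;> simp
  have hcsplit : ∀ k i, dC k i - 1 / n = pC k i +
      (if (n.factorial : ℝ) / (γ * n * M) ≤ dC k i then (0 : ℝ) else dC k i - 1 / n) := by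
    intro k i
    rw [hpC k i]
    split_ifs <;> simp
  -- light energies: `Σ 0² ≤ γ' E_A`, `Σ l_B² ≤ γ' E_B`, `Σ l_C² ≤ γ' E_C`
  have hla : ∑ _i : Fin n, ∑ _j : Fin n, (0 : ℝ) ^ 2 ≤
      100 * (1 + Real.log n) * L / M * ((n.factorial : ℝ) / α / ((n : ℝ) - 1)) := by
    have h0 : ∑ _i : Fin n, ∑ _j : Fin n, (0 : ℝ) ^ 2 = 0 := by simp
    rw [h0]; positivity
  have hlb : ∑ j : Fin n, ∑ k : Fin n,
      (if (n.factorial : ℝ) / (β * n * M) ≤ dB j k then (0 : ℝ) else dB j k - 1 / n) ^ 2 ≤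
      100 * (1 + Real.log n) * L / M * ((n.factorial : ℝ) / β / ((n : ℝ) - 1)) :=
    keptSplitBC_light hβ hM hn1' hc0 hLB hL0 hF0 hlB
  have hlc : ∑ k : Fin n, ∑ i : Fin n,
      (if (n.factorial : ℝ) / (γ * n * M) ≤ dC k i then (0 : ℝ) else dC k i - 1 / n) ^ 2 ≤
      100 * (1 + Real.log n) * L / M * ((n.factorial : ℝ) / γ / ((n : ℝ) - 1)) :=
    keptSplitBC_light hγ hM hn1' hc0 hLC hL0 hF0 hlC
  -- the pinning with `δ₀` grouped
  have hpin' : 1 - ((n.factorial : ℝ) / (2 * N) +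
        (n.factorial : ℝ) * Real.sqrt (n.factorial : ℝ) /
          (2 * N * Real.sqrt (((n * (n - 1) : ℕ) : ℝ) / 6))) ≤
      -((n : ℝ) - 1) * ∑ i : Fin n, ∑ j : Fin n, ∑ k : Fin n,
        (dA i j - 1 / n) * (dB j k - 1 / n) * (dC k i - 1 / n) := by
    rw [← sub_sub]; exact hpin
  -- the kept-term lemma
  have key : 1 - ((n.factorial : ℝ) / (2 * N) +
        (n.factorial : ℝ) * Real.sqrt (n.factorial : ℝ) /
          (2 * N * Real.sqrt (((n * (n - 1) : ℕ) : ℝ) / 6))) -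
        3 * ((n : ℝ) - 1) * Real.sqrt (100 * (1 + Real.log n) * L / M) *
          Real.sqrt ((n.factorial : ℝ) / α / ((n : ℝ) - 1) * ((n.factorial : ℝ) / β / ((n : ℝ) - 1)) *
            ((n.factorial : ℝ) / γ / ((n : ℝ) - 1))) ≤
      -((n : ℝ) - 1) * ∑ i : Fin n, ∑ j : Fin n, ∑ k : Fin n,
        (dA i j - 1 / n) * pB j k * pC k i :=
    kept_ge_of_split (fun i j => dA i j - 1 / n) (fun j k => dB j k - 1 / n)
      (fun k i => dC k i - 1 / n) (fun i j => dA i j - 1 / n) (fun _ _ => 0) pB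
      (fun j k => if (n.factorial : ℝ) / (β * n * M) ≤ dB j k then (0 : ℝ) else dB j k - 1 / n) pC
      (fun k i => if (n.factorial : ℝ) / (γ * n * M) ≤ dC k i then (0 : ℝ) else dC k i - 1 / n)
      hasplit hbsplit hcsplit hn1 _ _ _ _ _ hEA0 hEB0 hEC0 hg0 hb2 hc2 hpa hpb hla hlb hlc hpin'
  -- the loss identity `3(n-1)√γ'√(E_A E_B E_C) = 3√γ'·F/√(n-1)`
  have hI := keptSplitBC_sqrt_identity hF0 hα hβ hγ hN hαβγ hm
  have hfin : 3 * ((n : ℝ) - 1) * Real.sqrt (100 * (1 + Real.log n) * L / M) *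
      Real.sqrt ((n.factorial : ℝ) / α / ((n : ℝ) - 1) * ((n.factorial : ℝ) / β / ((n : ℝ) - 1)) *
        ((n.factorial : ℝ) / γ / ((n : ℝ) - 1))) =
      3 * Real.sqrt (100 * (1 + Real.log n) * L / M) *
        ((n.factorial : ℝ) * Real.sqrt (n.factorial : ℝ) / N) / Real.sqrt ((n : ℝ) - 1) := by
    calc 3 * ((n : ℝ) - 1) * Real.sqrt (100 * (1 + Real.log n) * L / M) *
          Real.sqrt ((n.factorial : ℝ) / α / ((n : ℝ) - 1) * ((n.factorial : ℝ) / β / ((n : ℝ) - 1)) *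
            ((n.factorial : ℝ) / γ / ((n : ℝ) - 1)))
        = 3 * Real.sqrt (100 * (1 + Real.log n) * L / M) * (((n : ℝ) - 1) *
            Real.sqrt ((n.factorial : ℝ) / α / ((n : ℝ) - 1) *
              ((n.factorial : ℝ) / β / ((n : ℝ) - 1)) * ((n.factorial : ℝ) / γ / ((n : ℝ) - 1)))) := by
          ring
      _ = 3 * Real.sqrt (100 * (1 + Real.log n) * L / M) *
            ((n.factorial : ℝ) * Real.sqrt (n.factorial : ℝ) / N / Real.sqrt ((n : ℝ) - 1)) := by
          rw [hI]
      _ = _ := by ring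
  linarith [key, hfin]

/-- **Kept term when `B = T⁻¹U` and `C = U⁻¹S` are split.** For `n ≥ 40` and a parity-pure TPP
triple `S, T, U ⊆ S_n` of non-empty sets with profiles `d_A, d_B, d_C` of the three quotients,
`N = |S||T||U|`, parameters `M, L ≥ 1` with `16M ≤ K_B = n!/(|T||U|)`, `16M ≤ K_C = n!/(|U||S|)`,
`log(4n·n!/(|T||U|)), log(4n·n!/(|U||S|)) ≤ L`, and heavy parts `p_B = (d_B - 1/n)·[θ_B ≤ d_B]`,
`p_C = (d_C - 1/n)·[θ_C ≤ d_C]` (`θ_B = K_B/(nM)`, `θ_C = K_C/(nM)`), the kept term satisfies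
`1 - n!/(2N) - n!√(n!)/(2N√(n(n-1)/6)) - 3√(100(1+log n)L/M)·(n!√(n!)/N)/√(n-1)
  ≤ -(n-1)·Σ_{ijk} (d_A(i,j) - 1/n)·p_B(j,k)·p_C(k,i)`.
Proof: `kept_ge_of_split` with `E_A = K_A/(n-1)`, `E_B = K_B/(n-1)`, `E_C = K_C/(n-1)`,
`γ' = 100(1+log n)L/M`, fed by `pinning_normalized`, `pair_parseval` (injectivity of the quotient
maps, `injOn_quot_first/second`) and `pair_light_energy` (`θ ≥ 16/n ≥ 1/n`); the loss is
`3(n-1)√γ'√(E_A E_B E_C) = 3√γ'·F/√(n-1)` as `E_A E_B E_C = F²/(n-1)³`, `F = n!√(n!)/N`. [folklore] -/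
theorem kept_split_BC {n : ℕ} (hn : 40 ≤ n) {S T U : Finset (Equiv.Perm (Fin n))}
    (hTPP : TripleProductProperty S T U) (hS0 : S.Nonempty) (hT0 : T.Nonempty) (hU0 : U.Nonempty)
    (hS : ∀ s ∈ S, ∀ s' ∈ S, Equiv.Perm.sign s = Equiv.Perm.sign s')
    (hT : ∀ t ∈ T, ∀ t' ∈ T, Equiv.Perm.sign t = Equiv.Perm.sign t')
    (hU : ∀ u ∈ U, ∀ u' ∈ U, Equiv.Perm.sign u = Equiv.Perm.sign u')
    (dA dB dC pB pC : Fin n → Fin n → ℝ)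
    (hdA : ∀ i j, dA i j = (((S ×ˢ T).filter fun st => st.2 j = st.1 i).card : ℝ) / (S.card * T.card : ℕ))
    (hdB : ∀ j k, dB j k = (((T ×ˢ U).filter fun tu => tu.2 k = tu.1 j).card : ℝ) / (T.card * U.card : ℕ))
    (hdC : ∀ k i, dC k i = (((U ×ˢ S).filter fun us => us.2 i = us.1 k).card : ℝ) / (U.card * S.card : ℕ))
    (M L : ℝ) (hM : 1 ≤ M) (hL : 1 ≤ L)
    (hKB : 16 * M ≤ (n.factorial : ℝ) / (T.card * U.card : ℕ))
    (hKC : 16 * M ≤ (n.factorial : ℝ) / (U.card * S.card : ℕ))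
    (hLB : Real.log (4 * n * n.factorial / (T.card * U.card : ℕ)) ≤ L)
    (hLC : Real.log (4 * n * n.factorial / (U.card * S.card : ℕ)) ≤ L)
    (hpB : ∀ j k, pB j k =
      if (n.factorial : ℝ) / ((T.card * U.card : ℕ) * n * M) ≤ dB j k then dB j k - 1 / n else 0)
    (hpC : ∀ k i, pC k i =
      if (n.factorial : ℝ) / ((U.card * S.card : ℕ) * n * M) ≤ dC k i then dC k i - 1 / n else 0) :
    1 - ((n.factorial : ℝ) / (2 * (S.card * T.card * U.card : ℕ)) +
          (n.factorial : ℝ) * Real.sqrt (n.factorial : ℝ) /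
            (2 * (S.card * T.card * U.card : ℕ) * Real.sqrt (((n * (n - 1) : ℕ) : ℝ) / 6)) +
          3 * Real.sqrt (100 * (1 + Real.log n) * L / M) *
            ((n.factorial : ℝ) * Real.sqrt (n.factorial : ℝ) / (S.card * T.card * U.card : ℕ)) /
              Real.sqrt ((n : ℝ) - 1)) ≤
      -((n : ℝ) - 1) * ∑ i : Fin n, ∑ j : Fin n, ∑ k : Fin n, (dA i j - 1 / n) * pB j k * pC k i := by
  -- the three quotient maps are injective (pairwise part of the triple product property)
  have hinjA := injOn_quot_first hTPP hU0
  have hinjB := injOn_quot_second hTPP hS0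
  have hinjC := injOn_quot_first hTPP.rotate.rotate hT0
  -- Parseval bounds for the three profiles
  have hA2 := pair_parseval hn S T hS0 hT0 hinjA dA hdA
  have hB2 := pair_parseval hn T U hT0 hU0 hinjB dB hdB
  have hC2 := pair_parseval hn U S hU0 hS0 hinjC dC hdC
  -- sizes
  have hn1 : 1 ≤ n := by omega
  have hn0 : (0 : ℝ) < n := by exact_mod_cast (show 0 < n by omega)
  have hαpos : (0 : ℝ) < ((S.card * T.card : ℕ) : ℝ) := by
    exact_mod_cast Nat.mul_pos hS0.card_pos hT0.card_pos
  have hβpos : (0 : ℝ) < ((T.card * U.card : ℕ) : ℝ) := by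
    exact_mod_cast Nat.mul_pos hT0.card_pos hU0.card_pos
  have hγpos : (0 : ℝ) < ((U.card * S.card : ℕ) : ℝ) := by
    exact_mod_cast Nat.mul_pos hU0.card_pos hS0.card_pos
  have hNpos : (0 : ℝ) < ((S.card * T.card * U.card : ℕ) : ℝ) := by
    exact_mod_cast Nat.mul_pos (Nat.mul_pos hS0.card_pos hT0.card_pos) hU0.card_pos
  have hαβγ : ((S.card * T.card : ℕ) : ℝ) * ((T.card * U.card : ℕ) : ℝ) * ((U.card * S.card : ℕ) : ℝ) =
      ((S.card * T.card * U.card : ℕ) : ℝ) ^ 2 := by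
    push_cast; ring
  -- the heavy thresholds are at least `1/n`, so the light-cell energies are controlled
  have hθB : 1 / (n : ℝ) ≤ (n.factorial : ℝ) / ((T.card * U.card : ℕ) * n * M) :=
    keptSplitBC_threshold hβpos hM hn0 hKB
  have hθC : 1 / (n : ℝ) ≤ (n.factorial : ℝ) / ((U.card * S.card : ℕ) * n * M) :=
    keptSplitBC_threshold hγpos hM hn0 hKC
  have hlB := pair_light_energy hn1 T U hT0 hU0 hinjB dB hdB _ hθB
  have hlC := pair_light_energy hn1 U S hU0 hS0 hinjC dC hdC _ hθC
  -- the pinning, rewritten in terms of `d_A, d_B, d_C`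
  have hpin := pinning_normalized n hn S T U hTPP hS0 hT0 hU0 hS hT hU
  have hsum : ∑ i : Fin n, ∑ j : Fin n, ∑ k : Fin n,
        ((((S ×ˢ T).filter fun st => st.2 j = st.1 i).card : ℝ) / (S.card * T.card : ℕ) - 1 / n) *
          ((((T ×ˢ U).filter fun tu => tu.2 k = tu.1 j).card : ℝ) / (T.card * U.card : ℕ) - 1 / n) *
          ((((U ×ˢ S).filter fun us => us.2 i = us.1 k).card : ℝ) / (U.card * S.card : ℕ) - 1 / n) =
      ∑ i : Fin n, ∑ j : Fin n, ∑ k : Fin n,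
        (dA i j - 1 / n) * (dB j k - 1 / n) * (dC k i - 1 / n) := by
    refine Finset.sum_congr rfl fun i _ => Finset.sum_congr rfl fun j _ =>
      Finset.sum_congr rfl fun k _ => ?_
    rw [hdA, hdB, hdC]
  rw [hsum] at hpin
  exact kept_split_BC_core hn hαpos hβpos hγpos hNpos hαβγ dA dB dC pB pC M L hM hL hLB hLC hpB hpC
    hA2 hB2 hC2 hlB hlC hpin

end Summit.MatrixMultiplication.MatrixMultiplication.Theorems.PolynomialSlack
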